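import Literature.Geometry.Hyperkaehler.LefschetzTwistorCommutators
import Literature.Geometry.Kaehler.ComplexTorusIntersectionCharpoly
import Literature.Geometry.Kaehler.ComplexTorusHodgeIndexSignature
import HarnessLib

/-!
# `NS(X) ⊗ ℚ ≅` the Rosati-invariants of `End⁰(X)` through the total Lie algebra:
# `[e_λ, f_κ]|_{H¹} = σ_λ^* − ½ Tr(σ_λ)` (Looijenga–Lunts 1997, §3 Proposition (3.5))

Topic `Literature/Geometry/Kaehler`, namespace `Literature.Geometry.Kaehler.ComplexTorus`; lane `lit-hodgefound`
(Track 2 foundations library), Layer A1 «complex tori · H^k = ⋀^k H¹ · Hodge decomposition», skeleton seat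
`lit-hodgefound-skel-1` (generation 22), row **A1-50** of `run/shared/lean/pub/lit-hodgefound/SKELETON.md`: the
numbered proposition of Looijenga–Lunts §3 that follows (3.3) (row A1-43, `ComplexTorusTotalLieAlgebra`: the total
Lie algebra `𝔤_tot(X; ℝ) = ρ(𝔰𝔬(V ⊕ V^*))` of the complex torus `X = E/Λ` on `H•(X, ℂ) = ⋀• V^* ⊗ ℂ = GForm E ℂ`,
`V = H₁(X; ℝ) = E`, with `e_κ = lefschetzG κ`, `f_κ = lefschetzDualG κ`, `h = countingG E = deg − g`) and (3.4)
(row A1-44, `ComplexTorusKaehlerLieAlgebra`: `ψ₂ = upEnd`, `ψ₋₂ = lowEnd`, the flat map `κ♭ = flat κ`, the Kähler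
Lie algebra `𝔰𝔲(V ⊕ V̄^*)`). A JUNCTION row: everything is consumed BY NAME (see the dictionary), nothing restated.

## Source, verbatim (E. Looijenga, V. A. Lunts, *A Lie algebra attached to a projective variety*, Invent. Math.
129 (1997) 361–412 = arXiv:alg-geom/9604014 §3; held corpus text `paper:arxiv-alg-geom_9604014` p0014 L20–L56;
numbered arXiv text (galaxy `pdf:-4867714119441510100`) p0026 L1–L11, where the proposition carries the number (3.5))

* before (3.5): "We adhere to the convention to denote the `ℚ`-algebra `End(X) ⊗ ℚ` by `End⁰(X)` and we write
  `V_ℚ` for `H₁(X; ℚ)` and `V` for `H₁(X; ℝ)`. We think of `End⁰(X)` as a subalgebra of `End(V_ℚ)`; if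
  `J : V → V`, `J² = −1_V`, is the complex structure determined by the one of `X`, then `End⁰(X)` is centralizer
  of `J` in `End(V)` intersected with `End(V_ℚ)`. Likewise, `NS(X) ⊗ ℚ` may be identified with the `J`-invariants
  in `∧²V^*` intersected with `∧²V_ℚ^*`. If `κ ∈ NS(X)` is a polarization, then taking adjoints with respect to
  this form defines an (anti-)involution `†` in `End(V)`: `κ(σv, w) = κ(v, σ†w)`, which preserves `End⁰(X)`; it is
  called the Rosati involution defined by `κ`. A well-known fact can be stated as follows:"
* **(3.5) Proposition.** "If `λ ∈ NS(X)` then the restriction of `[e_λ, f_κ] ∈ 𝔤𝔩(∧•V^*)` to `V^*` is in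
  `End⁰(X)` (acting on `V^*` contragradiently) and is invariant under `†`; this defines an isomorphism of `NS(X)`
  onto the `†`-invariants in `End⁰(X)`."
* "*Proof.* For any bilinear form `λ : V × V → ℝ` there is a unique `σ ∈ End(V)` such that
  `λ(a, b) = κ(σ_λ a, b)`. The condition that `λ` be anti-symmetric is equivalent to that `σ_λ` be `†`-invariant;
  the condition that `λ` be `J`-invariant to that `σ_λ` be `J`-equivariant. If `λ` is skew-symmetric and is
  regarded as an element of `∧²V^*`, then eq. (**) shows that `[e_λ, f_κ]|V^*` is equal to `±σ^*_λ` plus a scalar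
  operator. The proposition follows."

The "well-known fact" is D. Mumford, *Abelian Varieties* §21 Application III / J. S. Milne, *Abelian Varieties*
Prop. 17.2 / H. Lange, *Abelian Varieties over the Complex Numbers* (2023) Prop. 2.4.12 (a) — in the tree as row
A2-31, `ComplexTorusNeronSeveriEndomorphisms.nsEquivSymmEnd : NS_ℚ(X) ≃ₗ[ℚ] End^s_ℚ(X)` (`L ↦ φ_{L₀}⁻¹ φ_L`,
rational representation `G₀⁻¹ G_L`), which §5 consumes by name.

## Dictionary (consumed by name)

* A1-43 FILE 1 `LinearAlgebra/Alternating/ExteriorAlgebraSpinorRepresentation`: `so E = 𝔰𝔬(V ⊕ V^*)`, `psi0`,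
  `spinorRepLin E = ρ`, the derivation extension `derivExt E σ = σ̃` ((3.2): `ρ(ψ₀σ) = σ̃ − ½Tr(σ)·1`).
* A1-44 `ComplexTorusKaehlerLieAlgebra`: `flat κ = κ♭ : V → V^*` (`x ↦ κ(x, ·)`), `flat_injective`, `flat_I_smul`,
  `lowEnd P = ψ₋₂(P)`, `lowEnd_mem_so_iff`, `formOfSkew` (a `2`-form from a skew map `V → V^*`),
  `frameSharp b = κ_b⁻¹` (the frame inverse), `IsSymplecticBasis.flat_frameSharp`, `twoForm_ext_of_basis`, `cxJt`.
* p06, row g14-#5 §0 (`Hyperkaehler/LefschetzTwistorCommutators`, namespace `ComplexTorus`):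
  `spinorRepLin_lowEnd_eq_lefschetzDualG` (`ρψ₋₂(P') = f_κ` for a skew `P'` with `κ♭ ∘ P' = 1`) and
  **`lie_lefschetzG_lefschetzDualG_eq_derivExt`**: `[e_λ, f_κ] = σ̃ − ½Tr(σ)·1` with `σ = λ♭ ∘ P'` — the bracket half
  of (3.5), whose docstring already points here; p06, row g14-#2 (`LinearAlgebra/Alternating/DerivationExtensionGraded`):
  `derivExt_precomp_apply` / `derivExt_precomp_of` (`σ̃_T = ad T` degreewise for `σ_T = (θ ↦ θ ∘ T)`),
  `trace_precomp` (`Tr σ_T = Tr T`); row g14-#1 (`DerivationExtension`): `adAlt T = ad T`, `adAlt_apply_one`.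
* skel-2, row A2-31 (`ComplexTorusNeronSeveriEndomorphisms`): `neronSeveriQ Φ = NS_ℚ(X)` (real `(1,1)`-forms rational
  on the lattice of `X = E/Φ(ℤ^ι)`), `symmEndRat Φ G₀ = End^s_ℚ(X)` (the Rosati-fixed elements of
  `endAlgRat Φ = End_ℚ(X)`, rational matrices commuting with `J_Φ = jMatrix Φ`), `nsToEnd Φ G₀ : L ↦ G₀⁻¹ G_L`,
  `nsToEnd_mem_symmEndRat`, **`nsEquivSymmEnd`** (Prop. 2.4.12 (a)); P-pre-07 (`ComplexTorusRosati`):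
  `rosati G A = G⁻¹ ᵗA G`, `rosati_eq_iff`; p28, row A2-31(e) (`ComplexTorusIntersectionCharpoly`):
  `twoForm_eq_twoForm_nsToEnd_mulVec` (`L(Φx, Φy) = η₀(Φ(G₀⁻¹G_L x), Φy)`); `ComplexTorusAnalyticCharpoly`:
  `analyticRepReal Φ Φ B = Φ ∘ B ∘ Φ⁻¹` (`ρ_a` over `ℝ`), `analyticRepHom Φ : End_ℚ(X) →+* End_ℂ(V)`,
  `trace_analyticRepReal`, `mul_jMatrix_eq_jMatrix_mul_iff`; `ComplexTorusPolarizationType`: `latticeGram Φ η`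
  (the Gram matrix `G` on the lattice basis), `dotProduct_latticeGram_mulVec`; `ComplexTorusHodgeIndexSignature`:
  `realOneOneForms E = H^{1,1}(X) ∩ H²(X; ℝ)` (the `J`-invariant real `2`-forms).

## What is formalised (definitions with bodies; theorems; NO named fact, no `sorry`)

* §1 the FRAME-FREE inverse of a non-degenerate real `2`-form `κ` (hypothesis `hnd : ∀ v ≠ 0, ∃ w, κ(v, w) ≠ 0`,
  as in rows A1-43/A1-44): **`flatEquiv hnd : V ≃ₗ[ℝ] V^*`** (`κ♭` is injective and `dim V^* = dim V`,
  `finrank_continuousDual_eq`, `flat_bijective`), **`sharp hnd = κ⁻¹ : V^* → V`** with `κ(κ⁻¹ξ, y) = ξ(y)`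
  (`twoForm_sharp_left`), `κ♭ ∘ κ⁻¹ = 1` (`flat_comp_sharp`), `κ⁻¹` skew (`sharp_skew`), `ψ₋₂(κ⁻¹) ∈ 𝔰𝔬(V ⊕ V^*)`,
  **`spinorRepLin_lowEnd_sharp : ρ(ψ₋₂(κ⁻¹)) = f_κ`** (row A1-43's "`f_κ = ∑ i_{a_{−k}} i_{a_k}`" without a frame) and
  `IsSymplecticBasis.frameSharp_eq_sharp` (A1-44's frame inverse IS `κ⁻¹`).
* §2 Looijenga–Lunts' **`sigma hnd λ = σ_λ := κ⁻¹ ∘ λ♭ ∈ End(V)`**: `κ(σ_λ a, b) = λ(a, b)` (`twoForm_sigma_left`),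
  "there is a unique `σ`" (`eq_sigma_of_forall`), `σ_κ = 1` (`sigma_self`), linearity in `λ` (`sigmaₗ`, `sigma_add`,
  `sigma_smul`), `sigma_injective`, `κ(a, σ_λ b) = λ(a, b)`; **"anti-symmetric ⇔ `†`-invariant"**:
  `κ(σ_λ a, b) = κ(a, σ_λ b)` (`twoForm_sigma_comm`), the `†`-invariants **`rosatiInvariants κ ⊆ End(V)`** of the
  Rosati (anti-)involution `κ(σ v, w) = κ(v, σ† w)` as a real subspace, the converse `twoFormOf τ = κ(τ ·, ·)`
  (`sigma_twoFormOf`, `twoFormOf_sigma`) and the linear isomorphism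
  **`twoFormEquivRosatiInvariants hnd : ⋀² V^* ≃ₗ[ℝ] rosatiInvariants κ`** (`finrank_rosatiInvariants`).
* §3 **"`J`-invariant ⇔ `J`-equivariant"** for a polarization `κ` of type `(1,1)`: `sigma_smul_I`
  (`σ_λ(ia) = iσ_λ(a)` for a real `(1,1)`-form `λ`), `type_one_one_of_sigma_smul_I`, `type_one_one_iff_sigma_comm`;
  `sigmaL` (continuous version), **`sigmaC : V →L[ℂ] V`** (the `ℂ`-linear upgrade: `σ_λ` lies in the centralizer of
  `J`); the `†`-invariants of the centralizer of `J`, **`rosatiInvariantsJ κ`**, and the isomorphism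
  **`realOneOneFormsEquivRosatiInvariantsJ hnd hκ : realOneOneForms E ≃ₗ[ℝ] rosatiInvariantsJ κ`** — (3.5) over `ℝ`:
  the real `(1,1)`-classes `H^{1,1}(X) ∩ H²(X; ℝ) ⊇ NS(X) ⊗ ℝ` correspond to the `J`-commuting `κ`-self-adjoint
  real endomorphisms of `V` (`finrank_rosatiInvariantsJ`).
* §4 THE BRACKET: `λ♭ ∘ κ⁻¹ = σ_λ^* := (θ ↦ θ ∘ σ_λ)` (`flat_comp_sharp_eq_precomp` — Looijenga–Lunts' "`±σ_λ^*`" with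
  the sign fixed), hence from p06's general-`P'` lemma **`lie_lefschetzG_lefschetzDualG_eq_derivExt_sigma`**:
  `[e_λ, f_κ] = σ̃_λ − ½ Tr_ℝ(σ_λ)·1` on `H•(X, ℂ)`, degreewise `([e_λ, f_κ] w)_k = ad(σ_λ) w_k − ½Tr(σ_λ) w_k`
  (`lie_lefschetzG_lefschetzDualG_apply`, `…_of`), and ON `H¹(X, ℂ) = V^* ⊗ ℂ`:
  **`lie_lefschetzG_lefschetzDualG_of_one : [e_λ, f_κ] (of 1 θ) = of 1 (θ ∘ σ_λ − ½ Tr_ℝ(σ_λ)·θ)`** — "the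
  restriction of `[e_λ, f_κ]` to `V^*` … is equal to `±σ_λ^*` plus a scalar operator" with the sign `+σ_λ^*` and the
  scalar `−½Tr_ℝ(σ_λ)` for the tree's conventions (`adAlt_eq_compContinuousLinearMap`: `ad T = (θ ↦ θ ∘ T)` on
  `1`-forms); consistency `λ = κ`: `σ_κ = 1`, `½Tr_ℝ(1_V) = g` (`half_trace_id`), so `[e_κ, f_κ]θ = (1 − g)θ`
  (`lie_lefschetzG_lefschetzDualG_of_one_self`) `= hθ` (`countingG_of_one`) — the tree's `𝔰𝔩₂`-relation
  `lie_lefschetzG_lefschetzDualG` re-derived through (3.5).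
* §5 "IS IN `End⁰(X)`" / "AN ISOMORPHISM OF `NS(X)` ONTO THE `†`-INVARIANTS IN `End⁰(X)`", for `X = E/Φ(ℤ^ι)`, the
  polarization `κ = η₀` with rational invertible Gram matrix `G₀` (every Riemann form,
  `IsRiemannForm.exists_ratMatrix_latticeGram_isUnit`; non-degeneracy `nondegenerate_of_map_ratCast`) and divisor
  classes `λ = L ∈ NS(X) ⊗ ℚ = neronSeveriQ Φ`: the dictionary **`analyticRepReal_mem_rosatiInvariants_iff`**
  (`ρ_a(B)` is `†`-invariant iff `ᵗB G = G B`, i.e. iff `rosati G B = B`: Looijenga–Lunts' `†` IS Lange's Rosati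
  involution in the rational representation), `analyticRepReal_map_mem_rosatiInvariants_iff`,
  `analyticRepReal_smul_I_iff` and **`analyticRepReal_map_mem_rosatiInvariantsJ_iff : ρ_a(A) ∈ rosatiInvariantsJ η₀ ↔
  A ∈ End^s_ℚ(X)`** (the `†`-invariants of `End⁰(X)` = `symmEndRat Φ G₀`); **`sigma_eq_analyticRepReal_nsToEnd :
  σ_L = ρ_a(G₀⁻¹ G_L) = ρ_a(φ_{L₀}⁻¹ φ_L)`** (so `σ_L` "is in `End⁰(X)`": `sigmaC_eq_analyticRepHom_nsToEnd`,
  `sigma_mem_rosatiInvariantsJ_neronSeveriQ`), the isomorphism clause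
  **`existsUnique_sigma_eq_analyticRepReal`** (every `A ∈ End^s_ℚ(X)` is `σ_L` for exactly one `L ∈ NS(X) ⊗ ℚ`,
  namely `nsEquivSymmEnd.symm A` — Lange's Prop. 2.4.12 (a) read through the dictionary, not re-proved),
  `sigma_injective_neronSeveriQ`, the scalar `Tr_ℝ σ_L = Tr(G₀⁻¹ G_L)` (a rational number: `trace_sigma_eq_ratCast_trace`),
  and the assembled statement **`lie_lefschetzG_lefschetzDualG_of_one_neronSeveriQ`**:
  `[e_L, f_{η₀}] θ = θ ∘ ρ_a(φ_{L₀}⁻¹ φ_L) − ½ Tr(G₀⁻¹ G_L) θ` on `H¹(X, ℂ)`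
  (`IsRiemannForm.exists_lie_lefschetzG_lefschetzDualG_of_one` for a polarised abelian variety).

SCOPE NOTES (faithfulness). (i) "`NS(X)`" in the isomorphism clause of (3.5) is `NS(X) ⊗ ℚ` (as in the source's
(3.7): "Its degree `2` summand is canonically isomorphic to `NS(X) ⊗ ℚ`"); integrally `λ ↦ σ_λ` lands in `End(X)`
only for a principal `κ` (row A2-31's `nsEquivSymmEndInt`, cited, not used). (ii) "acting on `V^*`
contragradiently" is rendered literally: on `H¹ = V^* ⊗ ℂ` the bracket is the transpose `σ_λ^* = (θ ↦ θ ∘ σ_λ)` plus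
the explicit scalar `−½Tr_ℝ(σ_λ)`; the source's "`±`" is resolved for the tree's `e`, `f`, `h`. (iii) Over `ℝ`, §3
identifies ALL real `(1,1)`-forms with ALL `J`-commuting `†`-invariant real endomorphisms; `NS(X) ⊗ ℝ` and
`End(X) ⊗ ℝ` are in general proper subspaces of these, and only the rational statement §5 speaks of `End⁰(X)`.
(iv) NOT formalised here: (3.6) (the Rosati involutions are conjugate under `(End(X) ⊗ ℝ)^×`) and (3.7) (the
Néron–Severi Lie algebra `𝔤_NS(X; ℚ)` is of Jordan type, `𝔤_{NS,0}` = the ideal generated by `End⁰(X)^+`,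
`End⁰(X) = 𝔤_{NS,0} × 𝔲(X)`), which need the definition of `𝔤_NS` on a rational carrier. Nothing in this file is a
case of the Hodge conjecture.

## References

* [LooijengaLunts1997] E. Looijenga, V. A. Lunts, *A Lie algebra attached to a projective variety*, Invent. Math.
  129 (1997), 361–412, §3 (3.1)–(3.3), (3.5), (3.7) (proof: "`Tr` denotes the `ℚ`-trace").
* [Lange2023AbelianVarietiesComplex] H. Lange, *Abelian Varieties over the Complex Numbers*, Grundlehren Text
  Edition, Springer (2023), §1.1.2 Prop. 1.1.6 (`ρ_a`, `ρ_r`), §1.4.2 Prop. 1.4.7, §1.5.1, §2.4.1 Prop. 2.4.2 (a)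
  (Rosati involution as the adjoint for `E`), §2.4.2 Prop. 2.4.12 (a) (`NS_ℚ(X) ≅ End^s_ℚ(X)`).
* [Lang2002] S. Lang, *Algebra*, 3rd ed., GTM 211 (2002), III §6 (dual module: `dim V^* = dim V`), XIII §5.
* [McDuffSalamon2017] D. McDuff, D. Salamon, *Introduction to Symplectic Topology*, 3rd ed., OUP (2017), §2.1
  (non-degenerate `2`-forms, `ω♭ : V ≅ V^*`).
-/

noncomputable section

open Module Function Complex
open scoped Matrix
open Literature.LinearAlgebra.Alternating
open Literature.LinearAlgebra.Alternating.GForm (of)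

attribute [local instance 100] LieRing.ofAssociativeRing

namespace Literature.Geometry.Kaehler

namespace ComplexTorus

/-! ### §1 The frame-free inverse `κ⁻¹ : V^* → V` of a non-degenerate real `2`-form -/

section Sharp

variable {E : Type*} [NormedAddCommGroup E] [NormedSpace ℂ E] [FiniteDimensional ℂ E]
  {κ : E [⋀^Fin 2]→L[ℝ] ℝ}

omit [NormedSpace ℂ E] [FiniteDimensional ℂ E] in
/-- `dim_ℝ V^* = dim_ℝ V` for the continuous dual of a finite-dimensional real normed space. [cite: Lang2002, III §6] -/
theorem finrank_continuousDual_eq [NormedSpace ℝ E] [FiniteDimensional ℝ E] :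
    finrank ℝ (E →L[ℝ] ℝ) = finrank ℝ E := by
  rw [← (LinearMap.toContinuousLinearMap : (E →ₗ[ℝ] ℝ) ≃ₗ[ℝ] (E →L[ℝ] ℝ)).finrank_eq]
  exact Subspace.dual_finrank_eq

/-- **A non-degenerate `2`-form has a bijective flat map `κ♭ : V → V^*`** (injective by non-degeneracy,
`flat_injective`; onto by `dim V^* = dim V`). [cite: LooijengaLunts1997, §3 (3.5) (proof: "there is a unique σ ∈ End(V) such that λ(a, b) = κ(σ_λ a, b)")] -/
theorem flat_bijective (hnd : ∀ v : E, v ≠ 0 → ∃ w : E, κ ![v, w] ≠ 0) : Bijective (flat κ) := by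
  refine ⟨flat_injective hnd, ?_⟩
  have hE : finrank ℝ E = finrank ℝ (E →L[ℝ] ℝ) := (finrank_continuousDual_eq (E := E)).symm
  exact (LinearMap.injective_iff_surjective_of_finrank_eq_finrank hE).1 (flat_injective hnd)

/-- **`κ♭` as a linear isomorphism `V ≃ V^*`** for a non-degenerate real `2`-form `κ` (a polarization).
[cite: LooijengaLunts1997, §3 (3.5) (proof)] -/
def flatEquiv (hnd : ∀ v : E, v ≠ 0 → ∃ w : E, κ ![v, w] ≠ 0) : E ≃ₗ[ℝ] (E →L[ℝ] ℝ) :=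
  LinearEquiv.ofBijective (flat κ) (flat_bijective hnd)

/-- `flatEquiv` is `κ♭` (definitional). [cite: LooijengaLunts1997, §3 (3.5) (proof)] -/
@[simp]
theorem flatEquiv_apply (hnd : ∀ v : E, v ≠ 0 → ∃ w : E, κ ![v, w] ≠ 0) (x : E) :
    flatEquiv hnd x = flat κ x := rfl

/-- **The inverse `κ⁻¹ : V^* → V` of the flat map** ("the sharp map"; Looijenga–Lunts' `2`-vector of `f_κ`,
`∑ₖ a_{-k} ∧ a_k` in a symplectic frame — here frame-free). [cite: LooijengaLunts1997, §3 proof of (3.3) and (3.5)] -/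
def sharp (hnd : ∀ v : E, v ≠ 0 → ∃ w : E, κ ![v, w] ≠ 0) : (E →L[ℝ] ℝ) →ₗ[ℝ] E :=
  (flatEquiv hnd).symm.toLinearMap

/-- `κ♭(κ⁻¹ ξ) = ξ`. [cite: LooijengaLunts1997, §3 (3.5) (proof)] -/
@[simp]
theorem flat_sharp (hnd : ∀ v : E, v ≠ 0 → ∃ w : E, κ ![v, w] ≠ 0) (ξ : E →L[ℝ] ℝ) :
    flat κ (sharp hnd ξ) = ξ :=
  (flatEquiv hnd).apply_symm_apply ξ

/-- `κ⁻¹(κ♭ x) = x`. [cite: LooijengaLunts1997, §3 (3.5) (proof)] -/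
@[simp]
theorem sharp_flat (hnd : ∀ v : E, v ≠ 0 → ∃ w : E, κ ![v, w] ≠ 0) (x : E) : sharp hnd (flat κ x) = x :=
  (flatEquiv hnd).symm_apply_apply x

/-- **`κ(κ⁻¹ ξ, y) = ξ(y)`.** [cite: LooijengaLunts1997, §3 (3.5) (proof)] -/
theorem twoForm_sharp_left (hnd : ∀ v : E, v ≠ 0 → ∃ w : E, κ ![v, w] ≠ 0) (ξ : E →L[ℝ] ℝ) (y : E) :
    κ ![sharp hnd ξ, y] = ξ y := by
  rw [← flat_apply, flat_sharp]

/-- `κ(x, κ⁻¹ ξ) = -ξ(x)`. [cite: LooijengaLunts1997, §3 (3.5) (proof)] -/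
theorem twoForm_sharp_right (hnd : ∀ v : E, v ≠ 0 → ∃ w : E, κ ![v, w] ≠ 0) (x : E) (ξ : E →L[ℝ] ℝ) :
    κ ![x, sharp hnd ξ] = -ξ x := by
  rw [twoForm_swap, twoForm_sharp_left]

/-- `κ♭ ∘ κ⁻¹ = 1` (the hypothesis `hκP'` of `lie_lefschetzG_lefschetzDualG_eq_derivExt`).
[cite: LooijengaLunts1997, §3 (3.5) (proof)] -/
theorem flat_comp_sharp (hnd : ∀ v : E, v ≠ 0 → ∃ w : E, κ ![v, w] ≠ 0) : flat κ ∘ₗ sharp hnd = 1 :=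
  LinearMap.ext fun ξ ↦ flat_sharp hnd ξ

/-- **`κ⁻¹` is skew: `ζ(κ⁻¹ ξ) = -ξ(κ⁻¹ ζ)`** (it is the `2`-vector dual to `κ`; the hypothesis `hP'` of
`lie_lefschetzG_lefschetzDualG_eq_derivExt`). [cite: LooijengaLunts1997, §3 proof of (3.3)] -/
theorem sharp_skew (hnd : ∀ v : E, v ≠ 0 → ∃ w : E, κ ![v, w] ≠ 0) (ξ ζ : E →L[ℝ] ℝ) :
    ζ (sharp hnd ξ) = -ξ (sharp hnd ζ) := by
  conv_lhs => rw [← flat_sharp hnd ζ, flat_apply]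
  rw [twoForm_sharp_right]

/-- `ψ₋₂(κ⁻¹) ∈ 𝔰𝔬(V ⊕ V^*)`. [cite: LooijengaLunts1997, §3 (3.1), proof of (3.3)] -/
theorem lowEnd_sharp_mem_so (hnd : ∀ v : E, v ≠ 0 → ∃ w : E, κ ![v, w] ≠ 0) : lowEnd (sharp hnd) ∈ so E :=
  (lowEnd_mem_so_iff _).2 (sharp_skew hnd)

/-- **`f_κ = ρ(ψ₋₂(κ⁻¹))`, frame-free**: the spinor representation sends the degree-`-2` element of the
`2`-vector `κ⁻¹` to the dual Lefschetz operator `Λ_κ` of the torus (row A1-43's "`f_κ … equal to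
∑ i_{a_{-k}} i_{a_k}`" without choosing the frame; `spinorRepLin_lowEnd_eq_lefschetzDualG`).
[cite: LooijengaLunts1997, §3 proof of (3.3)] -/
theorem spinorRepLin_lowEnd_sharp [Nontrivial E] (hnd : ∀ v : E, v ≠ 0 → ∃ w : E, κ ![v, w] ≠ 0) :
    spinorRepLin E (lowEnd (sharp hnd)) = lefschetzDualG κ :=
  spinorRepLin_lowEnd_eq_lefschetzDualG (sharp_skew hnd) (flat_comp_sharp hnd)

/-- **The frame inverse is the inverse**: in a symplectic frame `b` of `κ`, row A1-44's `κ_b⁻¹ = frameSharp b`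
is `κ⁻¹`. [cite: LooijengaLunts1997, §3 proof of (3.3)] -/
theorem IsSymplecticBasis.frameSharp_eq_sharp {n : ℕ} {b : Module.Basis (Fin n ⊕ Fin n) ℝ E}
    (hb : IsSymplecticBasis κ b) (hnd : ∀ v : E, v ≠ 0 → ∃ w : E, κ ![v, w] ≠ 0) :
    frameSharp b = sharp hnd :=
  LinearMap.ext fun ξ ↦ flat_injective hnd (by rw [hb.flat_frameSharp, flat_sharp])

end Sharp

/-! ### §2 Looijenga–Lunts' `σ_λ`: `λ(a, b) = κ(σ_λ a, b)`, and the Rosati involution `κ(σ v, w) = κ(v, σ† w)` -/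

section Sigma

variable {E : Type*} [NormedAddCommGroup E] [NormedSpace ℂ E] [FiniteDimensional ℂ E]
  {κ : E [⋀^Fin 2]→L[ℝ] ℝ} (hnd : ∀ v : E, v ≠ 0 → ∃ w : E, κ ![v, w] ≠ 0)

/-- **`σ_λ := κ⁻¹ ∘ λ♭ ∈ End(V)`**, the endomorphism of `V = H₁(X; ℝ)` attached to a real `2`-form `λ` by the
polarization `κ` ("there is a unique `σ ∈ End(V)` such that `λ(a, b) = κ(σ_λ a, b)`"; for divisor classes this is
Lange's `φ_{L₀}⁻¹ φ_L`, §5). [cite: LooijengaLunts1997, §3 (3.5) (proof)] -/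
def sigma (lam : E [⋀^Fin 2]→L[ℝ] ℝ) : E →ₗ[ℝ] E := sharp hnd ∘ₗ flat lam

/-- `σ_λ a = κ⁻¹(λ(a, ·))` (definitional). [cite: LooijengaLunts1997, §3 (3.5) (proof)] -/
theorem sigma_apply (lam : E [⋀^Fin 2]→L[ℝ] ℝ) (a : E) : sigma hnd lam a = sharp hnd (flat lam a) := rfl

/-- **`κ(σ_λ a, b) = λ(a, b)`.** [cite: LooijengaLunts1997, §3 (3.5) (proof)] -/
@[simp]
theorem twoForm_sigma_left (lam : E [⋀^Fin 2]→L[ℝ] ℝ) (a b : E) : κ ![sigma hnd lam a, b] = lam ![a, b] := by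
  rw [sigma_apply, twoForm_sharp_left, flat_apply]

/-- `κ♭ ∘ σ_λ = λ♭`. [cite: LooijengaLunts1997, §3 (3.5) (proof)] -/
theorem flat_comp_sigma (lam : E [⋀^Fin 2]→L[ℝ] ℝ) : flat κ ∘ₗ sigma hnd lam = flat lam :=
  LinearMap.ext fun a ↦ ContinuousLinearMap.ext fun b ↦ by
    rw [LinearMap.comp_apply, flat_apply, twoForm_sigma_left, flat_apply]

/-- **Uniqueness of `σ_λ`**: an endomorphism `τ` with `κ(τ a, b) = λ(a, b)` for all `a, b` is `σ_λ`
("there is a unique `σ ∈ End(V)`"). [cite: LooijengaLunts1997, §3 (3.5) (proof)] -/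
theorem eq_sigma_of_forall {lam : E [⋀^Fin 2]→L[ℝ] ℝ} {τ : E →ₗ[ℝ] E}
    (h : ∀ a b : E, κ ![τ a, b] = lam ![a, b]) : τ = sigma hnd lam := by
  refine LinearMap.ext fun a ↦ flat_injective hnd (ContinuousLinearMap.ext fun b ↦ ?_)
  rw [flat_apply, flat_apply, h, twoForm_sigma_left]

/-- **`σ_κ = 1`.** [cite: LooijengaLunts1997, §3 (3.5) (proof)] -/
@[simp]
theorem sigma_self : sigma hnd κ = LinearMap.id :=
  (eq_sigma_of_forall hnd fun _ _ ↦ rfl).symm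

/-- **`λ ↦ σ_λ` is `ℝ`-linear** (in `λ`). [cite: LooijengaLunts1997, §3 (3.5) (proof)] -/
def sigmaₗ : (E [⋀^Fin 2]→L[ℝ] ℝ) →ₗ[ℝ] (E →ₗ[ℝ] E) where
  toFun := sigma hnd
  map_add' lam mu := (eq_sigma_of_forall hnd fun a b ↦ by
    rw [LinearMap.add_apply, twoForm_add_left, twoForm_sigma_left, twoForm_sigma_left,
      ContinuousAlternatingMap.add_apply]).symm
  map_smul' c lam := (eq_sigma_of_forall hnd fun a b ↦ by
    rw [LinearMap.smul_apply, twoForm_smul_left, twoForm_sigma_left, ContinuousAlternatingMap.smul_apply,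
      smul_eq_mul, RingHom.id_apply]).symm

/-- unfolding of `sigmaₗ` (definitional). [cite: LooijengaLunts1997, §3 (3.5) (proof)] -/
@[simp]
theorem sigmaₗ_apply (lam : E [⋀^Fin 2]→L[ℝ] ℝ) : sigmaₗ hnd lam = sigma hnd lam := rfl

/-- `σ_{λ + μ} = σ_λ + σ_μ`. [cite: LooijengaLunts1997, §3 (3.5) (proof)] -/
theorem sigma_add (lam mu : E [⋀^Fin 2]→L[ℝ] ℝ) : sigma hnd (lam + mu) = sigma hnd lam + sigma hnd mu :=
  (sigmaₗ hnd).map_add lam mu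

/-- `σ_{cλ} = c σ_λ`. [cite: LooijengaLunts1997, §3 (3.5) (proof)] -/
theorem sigma_smul (c : ℝ) (lam : E [⋀^Fin 2]→L[ℝ] ℝ) : sigma hnd (c • lam) = c • sigma hnd lam :=
  (sigmaₗ hnd).map_smul c lam

/-- **`λ ↦ σ_λ` is injective** (`λ` is recovered as `κ(σ_λ ·, ·)`). [cite: LooijengaLunts1997, §3 (3.5)] -/
theorem sigma_injective : Injective (sigma hnd) := fun lam mu h ↦
  twoForm_ext_of_basis (Module.finBasis ℝ E) fun p q ↦ by
    rw [← twoForm_sigma_left hnd lam, ← twoForm_sigma_left hnd mu, h]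

/-- **`κ(a, σ_λ b) = λ(a, b)`** (because `λ` and `κ` are both alternating). [cite: LooijengaLunts1997, §3 (3.5) (proof)] -/
theorem twoForm_sigma_right (lam : E [⋀^Fin 2]→L[ℝ] ℝ) (a b : E) : κ ![a, sigma hnd lam b] = lam ![a, b] := by
  rw [twoForm_swap κ, twoForm_sigma_left, twoForm_swap lam, neg_neg]

/-- **"The condition that `λ` be anti-symmetric is equivalent to that `σ_λ` be `†`-invariant"**: for the
alternating `λ`, `σ_λ` is fixed by the Rosati (anti-)involution of `κ`, `κ(σ_λ a, b) = κ(a, σ_λ b)`.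
[cite: LooijengaLunts1997, §3 (3.5) (proof)] -/
theorem twoForm_sigma_comm (lam : E [⋀^Fin 2]→L[ℝ] ℝ) (a b : E) :
    κ ![sigma hnd lam a, b] = κ ![a, sigma hnd lam b] := by
  rw [twoForm_sigma_left, twoForm_sigma_right]

variable (κ) in
/-- **The `†`-invariants of `End(V)`** for the Rosati (anti-)involution `κ(σ v, w) = κ(v, σ† w)` defined by the
polarization `κ`: the real endomorphisms `τ` of `V = H₁(X; ℝ)` with `κ(τ a, b) = κ(a, τ b)` (the `κ`-self-adjoint
ones), a real subspace of `End(V)`. [cite: LooijengaLunts1997, §3 before (3.5) ("taking adjoints with respect to this form defines an (anti-)involution † in End(V)")] -/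
def rosatiInvariants : Submodule ℝ (E →ₗ[ℝ] E) where
  carrier := {τ | ∀ a b : E, κ ![τ a, b] = κ ![a, τ b]}
  zero_mem' a b := by
    have h1 : κ ![(0 : E), b] = 0 := by rw [← zero_smul ℝ b, twoForm_smul_left, zero_mul]
    have h2 : κ ![a, (0 : E)] = 0 := by rw [← zero_smul ℝ a, twoForm_smul_right, zero_mul]
    rw [LinearMap.zero_apply, LinearMap.zero_apply, h1, h2]
  add_mem' {τ τ'} hτ hτ' a b := by
    simp only [Set.mem_setOf_eq] at hτ hτ'
    rw [LinearMap.add_apply, LinearMap.add_apply, twoForm_add_left, twoForm_add_right, hτ, hτ']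
  smul_mem' c τ hτ a b := by
    simp only [Set.mem_setOf_eq] at hτ
    rw [LinearMap.smul_apply, LinearMap.smul_apply, twoForm_smul_left, twoForm_smul_right, hτ]

omit [FiniteDimensional ℂ E] in
/-- Membership in the `†`-invariants: `κ(τ a, b) = κ(a, τ b)` for all `a, b`. [cite: LooijengaLunts1997, §3 before (3.5)] -/
theorem mem_rosatiInvariants_iff {τ : E →ₗ[ℝ] E} :
    τ ∈ rosatiInvariants κ ↔ ∀ a b : E, κ ![τ a, b] = κ ![a, τ b] :=
  Iff.rfl

/-- **`σ_λ` is `†`-invariant.** [cite: LooijengaLunts1997, §3 (3.5)] -/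
theorem sigma_mem_rosatiInvariants (lam : E [⋀^Fin 2]→L[ℝ] ℝ) : sigma hnd lam ∈ rosatiInvariants κ :=
  twoForm_sigma_comm hnd lam

/-- For a `†`-invariant `τ` the bilinear form `κ(τ ·, ·)` is alternating (skew). [cite: LooijengaLunts1997, §3 (3.5) (proof)] -/
theorem flat_comp_skew_of_mem {τ : E →ₗ[ℝ] E} (hτ : τ ∈ rosatiInvariants κ) (x y : E) :
    (flat κ ∘ₗ τ) x y = -(flat κ ∘ₗ τ) y x := by
  rw [LinearMap.comp_apply, LinearMap.comp_apply, flat_apply, flat_apply, hτ y x, twoForm_swap κ]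

/-- **The `2`-form `λ_τ = κ(τ ·, ·)` of a `†`-invariant endomorphism `τ`** (the converse direction of
"anti-symmetric ⇔ `†`-invariant"; row A1-44's `formOfSkew` of the skew map `κ♭ ∘ τ`).
[cite: LooijengaLunts1997, §3 (3.5) (proof)] -/
def twoFormOf (τ : rosatiInvariants κ) : E [⋀^Fin 2]→L[ℝ] ℝ := formOfSkew (flat κ ∘ₗ (τ : E →ₗ[ℝ] E))

/-- `λ_τ(a, b) = κ(τ a, b)`. [cite: LooijengaLunts1997, §3 (3.5) (proof)] -/
@[simp]
theorem twoFormOf_apply (τ : rosatiInvariants κ) (a b : E) : twoFormOf τ ![a, b] = κ ![(τ : E →ₗ[ℝ] E) a, b] := by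
  rw [twoFormOf, formOfSkew_apply (flat_comp_skew_of_mem τ.2), LinearMap.comp_apply, flat_apply]

/-- `σ_{λ_τ} = τ`. [cite: LooijengaLunts1997, §3 (3.5) (proof)] -/
theorem sigma_twoFormOf (τ : rosatiInvariants κ) : sigma hnd (twoFormOf τ) = τ :=
  (eq_sigma_of_forall hnd fun a b ↦ (twoFormOf_apply τ a b).symm).symm

/-- `λ_{σ_λ} = λ`. [cite: LooijengaLunts1997, §3 (3.5) (proof)] -/
theorem twoFormOf_sigma (lam : E [⋀^Fin 2]→L[ℝ] ℝ) :
    twoFormOf ⟨sigma hnd lam, sigma_mem_rosatiInvariants hnd lam⟩ = lam :=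
  twoForm_ext_of_basis (Module.finBasis ℝ E) fun p q ↦ by rw [twoFormOf_apply, twoForm_sigma_left]

/-- **"For any bilinear form `λ` there is a unique `σ` … anti-symmetric ⇔ `†`-invariant"**: `λ ↦ σ_λ` is a
linear isomorphism of the real `2`-forms `⋀² V^* = H²(X; ℝ)` onto the `†`-invariants of `End(V)` for the
Rosati involution of the polarization `κ`, with inverse `τ ↦ κ(τ ·, ·)`. [cite: LooijengaLunts1997, §3 (3.5) (proof)] -/
def twoFormEquivRosatiInvariants : (E [⋀^Fin 2]→L[ℝ] ℝ) ≃ₗ[ℝ] rosatiInvariants κ where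
  toFun lam := ⟨sigma hnd lam, sigma_mem_rosatiInvariants hnd lam⟩
  map_add' lam mu := Subtype.ext (sigma_add hnd lam mu)
  map_smul' c lam := Subtype.ext (sigma_smul hnd c lam)
  invFun := twoFormOf
  left_inv lam := twoFormOf_sigma hnd lam
  right_inv τ := Subtype.ext (sigma_twoFormOf hnd τ)

/-- unfolding of `twoFormEquivRosatiInvariants` (definitional). [cite: LooijengaLunts1997, §3 (3.5)] -/
@[simp]
theorem coe_twoFormEquivRosatiInvariants_apply (lam : E [⋀^Fin 2]→L[ℝ] ℝ) :
    ((twoFormEquivRosatiInvariants hnd lam : rosatiInvariants κ) : E →ₗ[ℝ] E) = sigma hnd lam := rfl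

include hnd in
/-- `dim_ℝ {†-invariants of End(V)} = dim_ℝ ⋀² V^*` (`= g(2g - 1)` for `dim_ℝ V = 2g`).
[cite: LooijengaLunts1997, §3 (3.5) (proof)] -/
theorem finrank_rosatiInvariants :
    finrank ℝ (rosatiInvariants κ) = finrank ℝ (E [⋀^Fin 2]→L[ℝ] ℝ) :=
  ((twoFormEquivRosatiInvariants hnd).finrank_eq).symm

end Sigma


/-! ### §3 "`λ` is `J`-invariant iff `σ_λ` is `J`-equivariant": the real `(1,1)`-classes and the
`†`-invariants of the centralizer of `J` -/

section ComplexStructure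

variable {E : Type*} [NormedAddCommGroup E] [NormedSpace ℂ E] [FiniteDimensional ℂ E]
  {κ : E [⋀^Fin 2]→L[ℝ] ℝ} (hnd : ∀ v : E, v ≠ 0 → ∃ w : E, κ ![v, w] ≠ 0)

/-- For a polarization `κ` of type `(1,1)` and a real `(1,1)`-form `λ`: **`σ_λ(i a) = i σ_λ(a)`** ("the
condition that `λ` be `J`-invariant [is equivalent] to that `σ_λ` be `J`-equivariant", one direction).
[cite: LooijengaLunts1997, §3 (3.5) (proof)] -/
theorem sigma_smul_I (hκ : ∀ u v : E, κ ![I • u, I • v] = κ ![u, v]) {lam : E [⋀^Fin 2]→L[ℝ] ℝ}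
    (hlam : ∀ u v : E, lam ![I • u, I • v] = lam ![u, v]) (a : E) :
    sigma hnd lam (I • a) = I • sigma hnd lam a := by
  refine flat_injective hnd (ContinuousLinearMap.ext fun b ↦ ?_)
  rw [flat_apply, twoForm_sigma_left, flat_I_smul hκ, _root_.neg_apply, cxJt_apply, flat_apply,
    twoForm_sigma_left, ← flat_apply lam (I • a) b, flat_I_smul hlam, _root_.neg_apply, cxJt_apply,
    flat_apply]

/-- Conversely: if `κ` is of type `(1,1)` and `σ_λ` commutes with `J`, then `λ` is of type `(1,1)`.
[cite: LooijengaLunts1997, §3 (3.5) (proof)] -/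
theorem type_one_one_of_sigma_smul_I (hκ : ∀ u v : E, κ ![I • u, I • v] = κ ![u, v])
    {lam : E [⋀^Fin 2]→L[ℝ] ℝ} (h : ∀ a : E, sigma hnd lam (I • a) = I • sigma hnd lam a) (u v : E) :
    lam ![I • u, I • v] = lam ![u, v] := by
  rw [← twoForm_sigma_left hnd lam, h, hκ, twoForm_sigma_left]

/-- **"`λ` is `J`-invariant iff `σ_λ` is `J`-equivariant"** (for a polarization `κ` of type `(1,1)`).
[cite: LooijengaLunts1997, §3 (3.5) (proof)] -/
theorem type_one_one_iff_sigma_comm (hκ : ∀ u v : E, κ ![I • u, I • v] = κ ![u, v])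
    (lam : E [⋀^Fin 2]→L[ℝ] ℝ) :
    (∀ u v : E, lam ![I • u, I • v] = lam ![u, v]) ↔ ∀ a : E, sigma hnd lam (I • a) = I • sigma hnd lam a :=
  ⟨fun hlam ↦ sigma_smul_I hnd hκ hlam, fun h ↦ type_one_one_of_sigma_smul_I hnd hκ h⟩

/-- `σ_λ` as a continuous real-linear map of the finite-dimensional `V`. [cite: LooijengaLunts1997, §3 (3.5)] -/
def sigmaL (lam : E [⋀^Fin 2]→L[ℝ] ℝ) : E →L[ℝ] E := LinearMap.toContinuousLinearMap (sigma hnd lam)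

/-- unfolding of `sigmaL` (definitional). [cite: LooijengaLunts1997, §3 (3.5)] -/
@[simp]
theorem sigmaL_apply (lam : E [⋀^Fin 2]→L[ℝ] ℝ) (a : E) : sigmaL hnd lam a = sigma hnd lam a := rfl

/-- `sigmaL` and `sigma` agree as linear maps. [cite: LooijengaLunts1997, §3 (3.5)] -/
@[simp]
theorem coe_sigmaL (lam : E [⋀^Fin 2]→L[ℝ] ℝ) : (sigmaL hnd lam : E →ₗ[ℝ] E) = sigma hnd lam := rfl

/-- **`σ_λ ∈ End_ℂ(V)`**: for `κ`, `λ` of type `(1,1)` the `J`-equivariant `σ_λ` is a `ℂ`-linear endomorphism of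
`V = E` ("`End⁰(X)` is [the] centralizer of `J` in `End(V)` intersected with `End(V_ℚ)`" — the real points of
the first condition). [cite: LooijengaLunts1997, §3 (3.5)] -/
def sigmaC (hκ : ∀ u v : E, κ ![I • u, I • v] = κ ![u, v]) {lam : E [⋀^Fin 2]→L[ℝ] ℝ}
    (hlam : ∀ u v : E, lam ![I • u, I • v] = lam ![u, v]) : E →L[ℂ] E :=
  toComplexLinear (sigmaL hnd lam) (sigma_smul_I hnd hκ hlam)

/-- unfolding of `sigmaC` (definitional). [cite: LooijengaLunts1997, §3 (3.5)] -/
@[simp]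
theorem sigmaC_apply (hκ : ∀ u v : E, κ ![I • u, I • v] = κ ![u, v]) {lam : E [⋀^Fin 2]→L[ℝ] ℝ}
    (hlam : ∀ u v : E, lam ![I • u, I • v] = lam ![u, v]) (a : E) : sigmaC hnd hκ hlam a = sigma hnd lam a := rfl

variable (κ) in
/-- **The `†`-invariants of the centralizer of `J` in `End(V)`**: real endomorphisms `τ` of `V = H₁(X; ℝ)` with
`κ(τ a, b) = κ(a, τ b)` and `τ(i a) = i τ(a)` — the real vector space whose rational points Looijenga–Lunts
identify with the `†`-invariants of `End⁰(X)` ("`End⁰(X)` is [the] centralizer of `J` in `End(V)` intersected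
with `End(V_ℚ)`"). [cite: LooijengaLunts1997, §3 before (3.5)] -/
def rosatiInvariantsJ : Submodule ℝ (E →ₗ[ℝ] E) where
  carrier := {τ | τ ∈ rosatiInvariants κ ∧ ∀ a : E, τ (I • a) = I • τ a}
  zero_mem' := ⟨(rosatiInvariants κ).zero_mem, fun a ↦ by rw [LinearMap.zero_apply, LinearMap.zero_apply, smul_zero]⟩
  add_mem' {τ τ'} hτ hτ' := ⟨(rosatiInvariants κ).add_mem hτ.1 hτ'.1, fun a ↦ by
    rw [LinearMap.add_apply, LinearMap.add_apply, hτ.2, hτ'.2, smul_add]⟩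
  smul_mem' c τ hτ := ⟨(rosatiInvariants κ).smul_mem c hτ.1, fun a ↦ by
    rw [LinearMap.smul_apply, LinearMap.smul_apply, hτ.2, smul_comm]⟩

omit [FiniteDimensional ℂ E] in
/-- Membership in `rosatiInvariantsJ`: `†`-invariant and commuting with `J`. [cite: LooijengaLunts1997, §3 before (3.5)] -/
theorem mem_rosatiInvariantsJ_iff {τ : E →ₗ[ℝ] E} :
    τ ∈ rosatiInvariantsJ κ ↔ (∀ a b : E, κ ![τ a, b] = κ ![a, τ b]) ∧ ∀ a : E, τ (I • a) = I • τ a :=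
  Iff.rfl

omit [FiniteDimensional ℂ E] in
/-- `rosatiInvariantsJ κ ≤ rosatiInvariants κ`. [cite: LooijengaLunts1997, §3 before (3.5)] -/
theorem rosatiInvariantsJ_le : rosatiInvariantsJ κ ≤ rosatiInvariants κ := fun _ h ↦ h.1

/-- For a polarization of type `(1,1)`: `σ_λ ∈ rosatiInvariantsJ κ` for every real `(1,1)`-form `λ`.
[cite: LooijengaLunts1997, §3 (3.5)] -/
theorem sigma_mem_rosatiInvariantsJ (hκ : ∀ u v : E, κ ![I • u, I • v] = κ ![u, v])
    {lam : E [⋀^Fin 2]→L[ℝ] ℝ} (hlam : lam ∈ realOneOneForms E) : sigma hnd lam ∈ rosatiInvariantsJ κ :=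
  ⟨sigma_mem_rosatiInvariants hnd lam, sigma_smul_I hnd hκ hlam⟩

/-- For a polarization of type `(1,1)`: the `2`-form `κ(τ ·, ·)` of a `J`-commuting `†`-invariant `τ` is a real
`(1,1)`-form. [cite: LooijengaLunts1997, §3 (3.5) (proof)] -/
theorem twoFormOf_mem_realOneOneForms (hκ : ∀ u v : E, κ ![I • u, I • v] = κ ![u, v])
    (τ : rosatiInvariantsJ κ) : twoFormOf ⟨(τ : E →ₗ[ℝ] E), τ.2.1⟩ ∈ realOneOneForms E := fun u v ↦ by
  rw [twoFormOf_apply, twoFormOf_apply, τ.2.2, hκ]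

/-- **Looijenga–Lunts (3.5) over `ℝ`: `λ ↦ σ_λ` is a linear isomorphism of the real `(1,1)`-classes
`H^{1,1}(X) ∩ H²(X; ℝ) ⊇ NS(X) ⊗ ℝ` (row A2's `realOneOneForms`) onto the `†`-invariants of the centralizer of
`J` in `End(V)`**, for every polarization (indeed every non-degenerate real `(1,1)`-form) `κ` — the two
equivalences "anti-symmetric ⇔ `†`-invariant" and "`J`-invariant ⇔ `J`-equivariant" of the printed proof. The
rational statement (`NS(X) ⊗ ℚ ≅` the `†`-invariants of `End⁰(X)`) is §5. [cite: LooijengaLunts1997, §3 (3.5)] -/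
def realOneOneFormsEquivRosatiInvariantsJ (hκ : ∀ u v : E, κ ![I • u, I • v] = κ ![u, v]) :
    realOneOneForms E ≃ₗ[ℝ] rosatiInvariantsJ κ where
  toFun lam := ⟨sigma hnd lam, sigma_mem_rosatiInvariantsJ hnd hκ lam.2⟩
  map_add' lam mu := Subtype.ext (sigma_add hnd lam mu)
  map_smul' c lam := Subtype.ext (sigma_smul hnd c lam)
  invFun τ := ⟨twoFormOf ⟨(τ : E →ₗ[ℝ] E), τ.2.1⟩, twoFormOf_mem_realOneOneForms hκ τ⟩
  left_inv lam := Subtype.ext (twoFormOf_sigma hnd lam)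
  right_inv τ := Subtype.ext (sigma_twoFormOf hnd ⟨(τ : E →ₗ[ℝ] E), τ.2.1⟩)

/-- unfolding of `realOneOneFormsEquivRosatiInvariantsJ` (definitional). [cite: LooijengaLunts1997, §3 (3.5)] -/
@[simp]
theorem coe_realOneOneFormsEquivRosatiInvariantsJ_apply (hκ : ∀ u v : E, κ ![I • u, I • v] = κ ![u, v])
    (lam : realOneOneForms E) :
    ((realOneOneFormsEquivRosatiInvariantsJ hnd hκ lam : rosatiInvariantsJ κ) : E →ₗ[ℝ] E) =
      sigma hnd (lam : E [⋀^Fin 2]→L[ℝ] ℝ) := rfl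

include hnd in
/-- `dim_ℝ {J-commuting †-invariants} = dim_ℝ H^{1,1}(X, ℝ)` (`= g²` for a torus of dimension `g`, row A1's
`finrank_hodgePQ_complexTorus_one_one`). [cite: LooijengaLunts1997, §3 (3.5)] -/
theorem finrank_rosatiInvariantsJ (hκ : ∀ u v : E, κ ![I • u, I • v] = κ ![u, v]) :
    finrank ℝ (rosatiInvariantsJ κ) = finrank ℝ (realOneOneForms E) :=
  ((realOneOneFormsEquivRosatiInvariantsJ hnd hκ).finrank_eq).symm

end ComplexStructure

/-! ### §4 Proposition (3.5): `[e_λ, f_κ] = σ̃_λ − ½ Tr(σ_λ)·1`, on `H¹(X) = V^*`: `θ ↦ θ ∘ σ_λ − ½ Tr(σ_λ) θ` -/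

section Bracket

variable {E : Type*} [NormedAddCommGroup E] [NormedSpace ℂ E] [FiniteDimensional ℂ E]
  {κ : E [⋀^Fin 2]→L[ℝ] ℝ} (hnd : ∀ v : E, v ≠ 0 → ∃ w : E, κ ![v, w] ≠ 0)

/-- **`λ♭ ∘ κ⁻¹ = σ_λ^*`**: the degree-`0` element `σ = σ(κ⁻¹, λ) ∈ 𝔤𝔩(V^*)` of `[ψ₂(λ), ψ₋₂(κ⁻¹)] = ψ₀(σ)`
(`lie_upEnd_lowEnd`) is precomposition with `σ_λ`: `(λ♭ κ⁻¹ ξ)(v) = λ(κ⁻¹ξ, v) = ξ(σ_λ v)` — Looijenga–Lunts'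
"`±σ_λ^*`" with the sign fixed by the tree's conventions. [cite: LooijengaLunts1997, §3 (3.5) (proof)] -/
theorem flat_comp_sharp_eq_precomp (lam : E [⋀^Fin 2]→L[ℝ] ℝ) :
    flat lam ∘ₗ sharp hnd =
      ((ContinuousLinearMap.precomp ℝ (sigmaL hnd lam) : (E →L[ℝ] ℝ) →L[ℝ] (E →L[ℝ] ℝ)) :
        Module.End ℝ (E →L[ℝ] ℝ)) := by
  refine LinearMap.ext fun ξ ↦ ContinuousLinearMap.ext fun v ↦ ?_
  rw [LinearMap.comp_apply, flat_apply, ContinuousLinearMap.coe_coe, ContinuousLinearMap.precomp_apply,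
    ContinuousLinearMap.comp_apply, sigmaL_apply, ← twoForm_sharp_left hnd ξ (sigma hnd lam v),
    twoForm_sigma_right]

/-- **Proposition (3.5), the bracket: `[e_λ, f_κ] = σ̃_λ − ½ Tr_ℝ(σ_λ)·1` on `H•(X, ℂ) = ⋀• V^* ⊗ ℂ`**, where
`σ̃_λ = derivExt(σ_λ^*)` is the degree-`0` derivation extending `θ ↦ θ ∘ σ_λ` (row A1-43's (3.2)
"`ψ₀(σ) ↦ σ̃ − ½Tr(σ)·1`" at `σ = σ_λ^*`, `Tr σ_λ^* = Tr σ_λ`; p06's `lie_lefschetzG_lefschetzDualG_eq_derivExt`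
at the frame-free inverse `κ⁻¹`). [cite: LooijengaLunts1997, §3 (3.2), (3.5)] -/
theorem lie_lefschetzG_lefschetzDualG_eq_derivExt_sigma [Nontrivial E] (lam : E [⋀^Fin 2]→L[ℝ] ℝ) :
    ⁅lefschetzG lam, lefschetzDualG κ⁆ =
      derivExt E ((ContinuousLinearMap.precomp ℝ (sigmaL hnd lam) : (E →L[ℝ] ℝ) →L[ℝ] (E →L[ℝ] ℝ)) :
          Module.End ℝ (E →L[ℝ] ℝ)) -
        ((1 / 2 : ℝ) * LinearMap.trace ℝ E (sigma hnd lam)) • (1 : Module.End ℂ (GForm E ℂ)) := by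
  rw [lie_lefschetzG_lefschetzDualG_eq_derivExt lam κ (sharp_skew hnd) (flat_comp_sharp hnd),
    flat_comp_sharp_eq_precomp, trace_precomp, coe_sigmaL]

/-- **(3.5) degreewise: `([e_λ, f_κ] w)_k = ad(σ_λ) w_k − ½ Tr_ℝ(σ_λ) w_k`** — on `H^k(X) = ⋀^k H¹` the bracket is
Verbitsky's derivation action of `σ_λ` (`(ad σ η)(v₁, …, v_k) = ∑ⱼ η(…, σ vⱼ, …)`) shifted by half the trace.
[cite: LooijengaLunts1997, §3 (3.2), (3.5)] -/
theorem lie_lefschetzG_lefschetzDualG_apply [Nontrivial E] (lam : E [⋀^Fin 2]→L[ℝ] ℝ) (w : GForm E ℂ) (m : ℕ) :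
    ⁅lefschetzG lam, lefschetzDualG κ⁆ w m =
      adAlt (sigmaL hnd lam) (w m) - ((1 / 2 : ℝ) * LinearMap.trace ℝ E (sigma hnd lam)) • w m := by
  rw [lie_lefschetzG_lefschetzDualG_eq_derivExt_sigma hnd, LinearMap.sub_apply, Pi.sub_apply,
    derivExt_precomp_apply, LinearMap.smul_apply, Module.End.one_apply, Pi.smul_apply]

/-- (3.5) on a homogeneous form: `[e_λ, f_κ] (of k η) = of k (ad(σ_λ) η − ½ Tr(σ_λ) η)`.
[cite: LooijengaLunts1997, §3 (3.2), (3.5)] -/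
theorem lie_lefschetzG_lefschetzDualG_of [Nontrivial E] (lam : E [⋀^Fin 2]→L[ℝ] ℝ) (k : ℕ)
    (η : E [⋀^Fin k]→L[ℝ] ℂ) :
    ⁅lefschetzG lam, lefschetzDualG κ⁆ (of k η) =
      of k (adAlt (sigmaL hnd lam) η - ((1 / 2 : ℝ) * LinearMap.trace ℝ E (sigma hnd lam)) • η) := by
  rw [lie_lefschetzG_lefschetzDualG_eq_derivExt_sigma hnd, LinearMap.sub_apply, derivExt_precomp_of,
    LinearMap.smul_apply, Module.End.one_apply, GForm.of_sub, GForm.of_smul]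

omit [NormedSpace ℂ E] [FiniteDimensional ℂ E] in
/-- On `1`-forms Verbitsky's `ad T` is precomposition: `ad T θ = θ ∘ T`. [cite: LooijengaLunts1997, §3 (3.1)] -/
theorem adAlt_eq_compContinuousLinearMap [NormedSpace ℝ E] (T : E →L[ℝ] E) (θ : E [⋀^Fin 1]→L[ℝ] ℂ) :
    adAlt T θ = θ.compContinuousLinearMap T := by
  refine ContinuousAlternatingMap.ext fun v ↦ ?_
  have hv : v = ![v 0] := by
    funext i
    fin_cases i
    rfl
  rw [hv, adAlt_apply_one, ContinuousAlternatingMap.compContinuousLinearMap_apply]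
  congr 1
  funext i
  fin_cases i
  rfl

/-- **Looijenga–Lunts (3.5), the printed statement: "the restriction of `[e_λ, f_κ] ∈ 𝔤𝔩(∧•V^*)` to `V^*` … is
equal to `±σ_λ^*` plus a scalar operator"** — on `H¹(X, ℂ) = V^* ⊗ ℂ`:
`[e_λ, f_κ] θ = θ ∘ σ_λ − ½ Tr_ℝ(σ_λ) θ`, with the sign `+σ_λ^*` and the scalar `−½ Tr_ℝ(σ_λ)` for the tree's
`e = lefschetzG`, `f = lefschetzDualG`, `h = countingG = deg − g` (check: `λ = κ` gives `(1 − g)θ = hθ`,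
`lie_lefschetzG_lefschetzDualG_of_one_self`). Here `σ_λ` is `†`-invariant (`sigma_mem_rosatiInvariants`) and, for
`κ`, `λ` of type `(1,1)`, `J`-equivariant (`sigma_smul_I`): it lies in the `†`-invariants of the centralizer of `J`,
and for a divisor class `λ ∈ NS(X) ⊗ ℚ` it is the analytic representation of `φ_{κ}⁻¹ φ_λ ∈ End⁰(X)` (§5).
[cite: LooijengaLunts1997, §3 (3.5)] -/
theorem lie_lefschetzG_lefschetzDualG_of_one [Nontrivial E] (lam : E [⋀^Fin 2]→L[ℝ] ℝ)
    (θ : E [⋀^Fin 1]→L[ℝ] ℂ) :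
    ⁅lefschetzG lam, lefschetzDualG κ⁆ (of 1 θ) =
      of 1 (θ.compContinuousLinearMap (sigmaL hnd lam) - ((1 / 2 : ℝ) * LinearMap.trace ℝ E (sigma hnd lam)) • θ) := by
  rw [lie_lefschetzG_lefschetzDualG_of hnd, adAlt_eq_compContinuousLinearMap]

/-- `½ Tr_ℝ(1_V) = g = dim_ℂ V`. [cite: LooijengaLunts1997, §3 proof of (3.3) ("acts on ⋀ˡV^* as multiplication by −n + l")] -/
theorem half_trace_id : (1 / 2 : ℝ) * LinearMap.trace ℝ E (LinearMap.id : E →ₗ[ℝ] E) = finrank ℂ E := by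
  rw [LinearMap.trace_id, finrank_real_of_complex E]
  push_cast
  ring

include hnd in
/-- **Consistency check `λ = κ`: `[e_κ, f_κ] = h` on `H¹`** — `σ_κ = 1`, so (3.5) gives
`[e_κ, f_κ] θ = θ − g θ = (1 − g) θ`, the value of `h = countingG` on `1`-forms (the tree's
`lie_lefschetzG_lefschetzDualG` of `ComplexTorusLefschetzSl2Triple`, re-derived through (3.5)).
[cite: LooijengaLunts1997, §3 proof of (3.3)] -/
theorem lie_lefschetzG_lefschetzDualG_of_one_self [Nontrivial E] (θ : E [⋀^Fin 1]→L[ℝ] ℂ) :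
    ⁅lefschetzG κ, lefschetzDualG κ⁆ (of 1 θ) = of 1 ((1 - (finrank ℂ E : ℝ)) • θ) := by
  have hθ : θ.compContinuousLinearMap (sigmaL hnd κ) = θ := by
    refine ContinuousAlternatingMap.ext fun v ↦ ?_
    rw [ContinuousAlternatingMap.compContinuousLinearMap_apply]
    congr 1
    funext i
    rw [Function.comp_apply, sigmaL_apply, sigma_self, LinearMap.id_apply]
  rw [lie_lefschetzG_lefschetzDualG_of_one hnd, sigma_self, half_trace_id, hθ]
  congr 1
  refine ContinuousAlternatingMap.ext fun v ↦ ?_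
  simp only [ContinuousAlternatingMap.sub_apply, ContinuousAlternatingMap.smul_apply, Complex.real_smul]
  push_cast
  ring

omit [FiniteDimensional ℂ E] in
/-- The same value from the `𝔰𝔩₂`-relation `[e_κ, f_κ] = h` of the tree (`countingG` is `k − g` on `k`-forms):
the two computations agree. [cite: LooijengaLunts1997, §1 (1.1), §3 (3.5)] -/
theorem countingG_of_one (θ : E [⋀^Fin 1]→L[ℝ] ℂ) :
    countingG E (of 1 θ) = of 1 ((1 - (finrank ℂ E : ℝ)) • θ) := by
  funext m
  rw [countingG_apply]
  rcases eq_or_ne m 1 with rfl | hm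
  · rw [GForm.of_apply_self, GForm.of_apply_self, Nat.cast_one]
    refine ContinuousAlternatingMap.ext fun v ↦ ?_
    simp only [ContinuousAlternatingMap.smul_apply, Complex.real_smul, smul_eq_mul]
    push_cast
    ring
  · rw [GForm.of_apply_of_ne hm, GForm.of_apply_of_ne hm, smul_zero]

end Bracket


/-! ### §5 "is in `End⁰(X)`" and "an isomorphism of `NS(X)` onto the `†`-invariants in `End⁰(X)`": the torus
`X = E/Φ(ℤ^ι)`, a polarization `η₀` with rational invertible Gram matrix, divisor classes `λ ∈ NS(X) ⊗ ℚ` -/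

section Rational

variable {ι : Type*} [Fintype ι] [DecidableEq ι] {E : Type*} [NormedAddCommGroup E] [NormedSpace ℂ E]
  [FiniteDimensional ℂ E] (Φ : (ι → ℝ) ≃L[ℝ] E) {η₀ : E [⋀^Fin 2]→L[ℝ] ℝ} {G₀ : Matrix ι ι ℚ}

omit [DecidableEq ι] [FiniteDimensional ℂ E] in
/-- Two real matrices with the same bilinear form `ᵗx M y` are equal. [folklore] -/
private theorem eq_of_forall_dotProduct_mulVec' {M N : Matrix ι ι ℝ}
    (h : ∀ x y : ι → ℝ, x ⬝ᵥ (M *ᵥ y) = x ⬝ᵥ (N *ᵥ y)) : M = N := by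
  classical
  exact Matrix.toBilin'.injective (LinearMap.ext₂ fun x y ↦ by
    rw [Matrix.toBilin'_apply', Matrix.toBilin'_apply', h])

omit [FiniteDimensional ℂ E] in
/-- **A `2`-form with invertible Gram matrix on the lattice basis is non-degenerate** (every polarization:
`IsRiemannForm.isUnit_det_latticeGram`). [cite: Lange2023AbelianVarietiesComplex, §1.4.2 Prop. 1.4.7 ("`φ_L` is an isogeny iff `H` is non-degenerate")] -/
theorem nondegenerate_of_isUnit_det_latticeGram (hG : IsUnit (latticeGram Φ η₀).det) :
    ∀ v : E, v ≠ 0 → ∃ w : E, η₀ ![v, w] ≠ 0 := by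
  intro v hv
  by_contra! h
  obtain ⟨x, rfl⟩ := Φ.surjective v
  have hx : x ᵥ* latticeGram Φ η₀ = 0 := by
    have h0 : ∀ y : ι → ℝ, (x ᵥ* latticeGram Φ η₀) ⬝ᵥ y = 0 := fun y ↦ by
      rw [← Matrix.dotProduct_mulVec, dotProduct_latticeGram_mulVec, h]
    simpa using h0 (x ᵥ* latticeGram Φ η₀)
  have hinj : Function.Injective (latticeGram Φ η₀).vecMul :=
    Matrix.vecMul_injective_iff_isUnit.2 ((Matrix.isUnit_iff_isUnit_det _).2 hG)
  have hx0 : x = 0 := hinj (show x ᵥ* latticeGram Φ η₀ = 0 ᵥ* latticeGram Φ η₀ by rw [hx, Matrix.zero_vecMul])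
  exact hv (by rw [hx0, map_zero])

omit [FiniteDimensional ℂ E] in
/-- The real Gram matrix realified from an invertible rational one is invertible. [cite: Lange2023AbelianVarietiesComplex, §1.4.2 Prop. 1.4.7] -/
theorem isUnit_det_latticeGram_of_map (hG₀ : G₀.map ((↑) : ℚ → ℝ) = latticeGram Φ η₀) (hdet : IsUnit G₀.det) :
    IsUnit (latticeGram Φ η₀).det := by
  rw [← hG₀, show G₀.map ((↑) : ℚ → ℝ) = (Rat.castHom ℝ).mapMatrix G₀ from rfl, ← RingHom.map_det]
  exact hdet.map _

omit [FiniteDimensional ℂ E] in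
/-- Non-degeneracy of a polarization with rational invertible Gram matrix (the standing hypotheses `hG₀`, `hdet` of
row A2-31's `nsEquivSymmEnd`). [cite: Lange2023AbelianVarietiesComplex, §1.4.2 Prop. 1.4.7] -/
theorem nondegenerate_of_map_ratCast (hG₀ : G₀.map ((↑) : ℚ → ℝ) = latticeGram Φ η₀) (hdet : IsUnit G₀.det) :
    ∀ v : E, v ≠ 0 → ∃ w : E, η₀ ![v, w] ≠ 0 :=
  nondegenerate_of_isUnit_det_latticeGram Φ (isUnit_det_latticeGram_of_map Φ hG₀ hdet)

omit [FiniteDimensional ℂ E] in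
/-- **Looijenga–Lunts' `†` is Lange's Rosati involution in the rational representation**: the real endomorphism
`Φ ∘ B ∘ Φ⁻¹` of `V` (analytic representation of the real matrix `B` on the lattice basis) is `†`-invariant for
`η₀` iff `ᵗB G = G B` for the Gram matrix `G` of `η₀` — i.e. iff `rosati G B = G⁻¹ ᵗB G = B`
(`rosati_eq_iff`). [cite: LooijengaLunts1997, §3 before (3.5)] [cite: Lange2023AbelianVarietiesComplex, §2.4.1 Prop. 2.4.2 (a)] -/
theorem analyticRepReal_mem_rosatiInvariants_iff (B : Matrix ι ι ℝ) :
    (analyticRepReal Φ Φ B : E →ₗ[ℝ] E) ∈ rosatiInvariants η₀ ↔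
      B.transpose * latticeGram Φ η₀ = latticeGram Φ η₀ * B := by
  have key : ∀ x y : ι → ℝ,
      (η₀ ![analyticRepReal Φ Φ B (Φ x), Φ y] = η₀ ![Φ x, analyticRepReal Φ Φ B (Φ y)] ↔
        x ⬝ᵥ ((B.transpose * latticeGram Φ η₀) *ᵥ y) = x ⬝ᵥ ((latticeGram Φ η₀ * B) *ᵥ y)) := fun x y ↦ by
    rw [analyticRepReal_apply, analyticRepReal_apply, ← dotProduct_latticeGram_mulVec,
      ← dotProduct_latticeGram_mulVec, ← Matrix.vecMul_transpose B x,
      ← Matrix.dotProduct_mulVec x Bᵀ (latticeGram Φ η₀ *ᵥ y), Matrix.mulVec_mulVec, Matrix.mulVec_mulVec]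
  rw [mem_rosatiInvariants_iff]
  constructor
  · intro h
    refine eq_of_forall_dotProduct_mulVec' fun x y ↦ (key x y).1 ?_
    have := h (Φ x) (Φ y)
    simpa only [ContinuousLinearMap.coe_coe] using this
  · intro h a b
    obtain ⟨x, rfl⟩ := Φ.surjective a
    obtain ⟨y, rfl⟩ := Φ.surjective b
    exact (key x y).2 (by rw [h])

omit [DecidableEq ι] [FiniteDimensional ℂ E] in
/-- Entrywise cast of a product of rational matrices. [folklore] -/
private theorem map_ratCast_mul'' (A B : Matrix ι ι ℚ) :
    (A * B).map (Rat.cast : ℚ → ℝ) = A.map (Rat.cast : ℚ → ℝ) * B.map (Rat.cast : ℚ → ℝ) :=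
  Matrix.map_mul (f := Rat.castHom ℝ)

omit [FiniteDimensional ℂ E] in
/-- For a RATIONAL matrix `A` and a polarization with rational invertible Gram matrix `G₀`: `ρ_a(A)` (over `ℝ`) is
`†`-invariant iff `A` is fixed by the Rosati involution `rosati G₀` of row A2's `ComplexTorusRosati`.
[cite: LooijengaLunts1997, §3 before (3.5)] [cite: Lange2023AbelianVarietiesComplex, §2.4.1 Prop. 2.4.2 (a)] -/
theorem analyticRepReal_map_mem_rosatiInvariants_iff (hG₀ : G₀.map ((↑) : ℚ → ℝ) = latticeGram Φ η₀)
    (hdet : IsUnit G₀.det) (A : Matrix ι ι ℚ) :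
    (analyticRepReal Φ Φ (A.map ((↑) : ℚ → ℝ)) : E →ₗ[ℝ] E) ∈ rosatiInvariants η₀ ↔ rosati G₀ A = A := by
  rw [analyticRepReal_mem_rosatiInvariants_iff, rosati_eq_iff hdet, ← hG₀, ← Matrix.transpose_map,
    ← map_ratCast_mul'', ← map_ratCast_mul'']
  exact ⟨fun h ↦ Matrix.map_injective Rat.cast_injective h, fun h ↦ by rw [h]⟩

omit [FiniteDimensional ℂ E] in
/-- `ρ_a(B)` commutes with `J` iff `B J_Φ = J_Φ B`. [cite: Lange2023AbelianVarietiesComplex, §1.1.2 Prop. 1.1.6] -/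
theorem analyticRepReal_smul_I_iff (B : Matrix ι ι ℝ) :
    (∀ a : E, (analyticRepReal Φ Φ B : E →ₗ[ℝ] E) (I • a) = I • (analyticRepReal Φ Φ B : E →ₗ[ℝ] E) a) ↔
      B * jMatrix Φ = jMatrix Φ * B := by
  rw [mul_jMatrix_eq_jMatrix_mul_iff]
  constructor
  · intro h x
    apply Φ.injective
    have h' : analyticRepReal Φ Φ B (I • Φ x) = I • analyticRepReal Φ Φ B (Φ x) := h (Φ x)
    rw [← analyticRepReal_apply Φ Φ B (latticeJ Φ x), apply_latticeJ, h', analyticRepReal_apply, apply_latticeJ]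
  · intro h a
    obtain ⟨x, rfl⟩ := Φ.surjective a
    show analyticRepReal Φ Φ B (I • Φ x) = I • analyticRepReal Φ Φ B (Φ x)
    rw [← apply_latticeJ, analyticRepReal_apply, analyticRepReal_apply, h, apply_latticeJ]

omit [FiniteDimensional ℂ E] in
/-- **The dictionary: Looijenga–Lunts' "`†`-invariants of `End⁰(X)`" are Lange's `End^s_ℚ(X)`.** For a rational
matrix `A` (an element of `End(V_ℚ)` on the lattice basis): `ρ_a(A)` lies in the `†`-invariants of the centralizer
of `J` in `End(V)` iff `A ∈ End^s_ℚ(X) = symmEndRat Φ G₀` (in `End_ℚ(X)` = commuting with `J`, and Rosati-fixed).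
[cite: LooijengaLunts1997, §3 before (3.5) ("End⁰(X) is centralizer of J in End(V) intersected with End(V_ℚ)")]
[cite: Lange2023AbelianVarietiesComplex, §2.4.2 (before Prop. 2.4.12)] -/
theorem analyticRepReal_map_mem_rosatiInvariantsJ_iff (hG₀ : G₀.map ((↑) : ℚ → ℝ) = latticeGram Φ η₀)
    (hdet : IsUnit G₀.det) (A : Matrix ι ι ℚ) :
    (analyticRepReal Φ Φ (A.map ((↑) : ℚ → ℝ)) : E →ₗ[ℝ] E) ∈ rosatiInvariantsJ η₀ ↔ A ∈ symmEndRat Φ G₀ := by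
  rw [mem_rosatiInvariantsJ_iff, ← mem_rosatiInvariants_iff, analyticRepReal_map_mem_rosatiInvariants_iff Φ hG₀ hdet,
    analyticRepReal_smul_I_iff, mem_symmEndRat_iff, mem_endAlgRat_iff, and_comm]

/-- **`σ_λ = ρ_a(φ_{L₀}⁻¹ φ_L)` for a divisor class**: for the polarization `κ = η₀` (rational invertible Gram
matrix `G₀`) and `λ = L ∈ NS(X) ⊗ ℚ = neronSeveriQ Φ`, Looijenga–Lunts' `σ_λ` is the analytic representation
`Φ ∘ (G₀⁻¹ G_L) ∘ Φ⁻¹` of Lange's `φ(L) = φ_{L₀}⁻¹ φ_L`, whose rational representation is `nsToEnd Φ G₀ L = G₀⁻¹ G_L`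
(row A2-31; `twoForm_eq_twoForm_nsToEnd_mulVec`: `L(Φx, Φy) = η₀(Φ(G₀⁻¹ G_L x), Φy)`).
[cite: LooijengaLunts1997, §3 (3.5)] [cite: Lange2023AbelianVarietiesComplex, §2.4.2 Prop. 2.4.12 (proof)] -/
theorem sigma_eq_analyticRepReal_nsToEnd (hG₀ : G₀.map ((↑) : ℚ → ℝ) = latticeGram Φ η₀) (hdet : IsUnit G₀.det)
    (L : neronSeveriQ Φ) :
    sigma (nondegenerate_of_map_ratCast Φ hG₀ hdet) (L : E [⋀^Fin 2]→L[ℝ] ℝ) =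
      (analyticRepReal Φ Φ ((nsToEnd Φ G₀ L).map ((↑) : ℚ → ℝ)) : E →ₗ[ℝ] E) := by
  refine (eq_sigma_of_forall _ fun a b ↦ ?_).symm
  obtain ⟨x, rfl⟩ := Φ.surjective a
  obtain ⟨y, rfl⟩ := Φ.surjective b
  rw [ContinuousLinearMap.coe_coe, analyticRepReal_apply, twoForm_eq_twoForm_nsToEnd_mulVec Φ hG₀ hdet L x y]

/-- The same on the lattice space: `σ_L(Φ x) = Φ(G₀⁻¹ G_L x)`. [cite: LooijengaLunts1997, §3 (3.5)] -/
theorem sigma_apply_eq_nsToEnd_mulVec (hG₀ : G₀.map ((↑) : ℚ → ℝ) = latticeGram Φ η₀) (hdet : IsUnit G₀.det)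
    (L : neronSeveriQ Φ) (x : ι → ℝ) :
    sigma (nondegenerate_of_map_ratCast Φ hG₀ hdet) (L : E [⋀^Fin 2]→L[ℝ] ℝ) (Φ x) =
      Φ ((nsToEnd Φ G₀ L).map ((↑) : ℚ → ℝ) *ᵥ x) := by
  rw [sigma_eq_analyticRepReal_nsToEnd Φ hG₀ hdet L, ContinuousLinearMap.coe_coe, analyticRepReal_apply]

/-- **`σ_λ = ρ_a(φ(L))` as `ℂ`-linear maps**: the `J`-equivariant `σ_L` (`sigmaC`) is the analytic representation
`analyticRepHom Φ` of `φ(L) = G₀⁻¹ G_L ∈ End^s_ℚ(X) ⊆ End_ℚ(X)` ("is in `End⁰(X)`").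
[cite: LooijengaLunts1997, §3 (3.5)] [cite: Lange2023AbelianVarietiesComplex, §1.1.2 p. 20 (`ρ_a`)] -/
theorem sigmaC_eq_analyticRepHom_nsToEnd (h₀ : ∀ u v : E, η₀ ![I • u, I • v] = η₀ ![u, v])
    (hG₀ : G₀.map ((↑) : ℚ → ℝ) = latticeGram Φ η₀) (hdet : IsUnit G₀.det) (L : neronSeveriQ Φ) :
    sigmaC (nondegenerate_of_map_ratCast Φ hG₀ hdet) h₀ L.2.1 =
      analyticRepHom Φ ⟨nsToEnd Φ G₀ L, (nsToEnd_mem_symmEndRat h₀ hG₀ hdet L).1⟩ := by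
  refine ContinuousLinearMap.ext fun a ↦ ?_
  obtain ⟨x, rfl⟩ := Φ.surjective a
  rw [sigmaC_apply, sigma_apply_eq_nsToEnd_mulVec Φ hG₀ hdet L x, analyticRepHom_apply_apply]

/-- **"is in `End⁰(X)` … and is invariant under `†`"**: `σ_L ∈ rosatiInvariantsJ η₀`, and its rational
representation `G₀⁻¹ G_L` lies in `End^s_ℚ(X)` (row A2-31's `nsToEnd_mem_symmEndRat`, recovered through the
dictionary `analyticRepReal_map_mem_rosatiInvariantsJ_iff`). [cite: LooijengaLunts1997, §3 (3.5)] -/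
theorem sigma_mem_rosatiInvariantsJ_neronSeveriQ (h₀ : ∀ u v : E, η₀ ![I • u, I • v] = η₀ ![u, v])
    (hG₀ : G₀.map ((↑) : ℚ → ℝ) = latticeGram Φ η₀) (hdet : IsUnit G₀.det) (L : neronSeveriQ Φ) :
    sigma (nondegenerate_of_map_ratCast Φ hG₀ hdet) (L : E [⋀^Fin 2]→L[ℝ] ℝ) ∈ rosatiInvariantsJ η₀ ∧
      nsToEnd Φ G₀ L ∈ symmEndRat Φ G₀ := by
  have h1 := sigma_mem_rosatiInvariantsJ (nondegenerate_of_map_ratCast Φ hG₀ hdet) h₀ L.2.1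
  exact ⟨h1, (analyticRepReal_map_mem_rosatiInvariantsJ_iff Φ hG₀ hdet _).1
    (sigma_eq_analyticRepReal_nsToEnd Φ hG₀ hdet L ▸ h1)⟩

/-- **"this defines an isomorphism of `NS(X)` onto the `†`-invariants in `End⁰(X)`"**: every `A ∈ End^s_ℚ(X)`
(a rational, `J`-commuting, Rosati-fixed matrix — the `†`-invariants of `End⁰(X)`) is `σ_L` for exactly one
divisor class `L ∈ NS(X) ⊗ ℚ`; the class is row A2-31's `(nsEquivSymmEnd Φ η₀ G₀ …).symm A` (Lange's
Prop. 2.4.12 (a), consumed by name) and uniqueness is `sigma_injective`. [cite: LooijengaLunts1997, §3 (3.5)]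
[cite: Lange2023AbelianVarietiesComplex, §2.4.2 Prop. 2.4.12 (a)] -/
theorem existsUnique_sigma_eq_analyticRepReal (h₀ : ∀ u v : E, η₀ ![I • u, I • v] = η₀ ![u, v])
    (hG₀ : G₀.map ((↑) : ℚ → ℝ) = latticeGram Φ η₀) (hdet : IsUnit G₀.det) (A : symmEndRat Φ G₀) :
    ∃! L : neronSeveriQ Φ, sigma (nondegenerate_of_map_ratCast Φ hG₀ hdet) (L : E [⋀^Fin 2]→L[ℝ] ℝ) =
      (analyticRepReal Φ Φ ((A : Matrix ι ι ℚ).map ((↑) : ℚ → ℝ)) : E →ₗ[ℝ] E) := by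
  refine ⟨(nsEquivSymmEnd Φ η₀ G₀ h₀ hG₀ hdet).symm A, ?_, fun L hL ↦ ?_⟩
  · dsimp only
    have hA : nsToEnd Φ G₀ ((nsEquivSymmEnd Φ η₀ G₀ h₀ hG₀ hdet).symm A) = (A : Matrix ι ι ℚ) := by
      have := congrArg (fun B : symmEndRat Φ G₀ ↦ (B : Matrix ι ι ℚ))
        ((nsEquivSymmEnd Φ η₀ G₀ h₀ hG₀ hdet).apply_symm_apply A)
      simpa only [coe_nsEquivSymmEnd_apply, nsToEnd_apply] using this
    rw [sigma_eq_analyticRepReal_nsToEnd Φ hG₀ hdet, hA]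
  · apply (nsEquivSymmEnd Φ η₀ G₀ h₀ hG₀ hdet).injective
    rw [LinearEquiv.apply_symm_apply]
    apply Subtype.ext
    rw [coe_nsEquivSymmEnd_apply, ← nsToEnd_apply]
    -- `nsToEnd L = A`: both have analytic representation `σ_L`
    have h : (analyticRepReal Φ Φ ((nsToEnd Φ G₀ L).map ((↑) : ℚ → ℝ)) : E →ₗ[ℝ] E) =
        (analyticRepReal Φ Φ ((A : Matrix ι ι ℚ).map ((↑) : ℚ → ℝ)) : E →ₗ[ℝ] E) := by
      rw [← sigma_eq_analyticRepReal_nsToEnd Φ hG₀ hdet L]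
      exact hL
    have h' : (nsToEnd Φ G₀ L).map ((↑) : ℚ → ℝ) = (A : Matrix ι ι ℚ).map ((↑) : ℚ → ℝ) := by
      refine Matrix.toLin'.injective (LinearMap.ext fun x ↦ ?_)
      rw [Matrix.toLin'_apply, Matrix.toLin'_apply]
      apply Φ.injective
      rw [← analyticRepReal_apply Φ Φ _ x, ← analyticRepReal_apply Φ Φ _ x]
      exact congrArg (fun f : E →ₗ[ℝ] E ↦ f (Φ x)) h
    exact Matrix.map_injective Rat.cast_injective h'

/-- The map of (3.5) on `NS(X) ⊗ ℚ` is injective and `ℚ`-linear (`sigmaₗ` restricted).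
[cite: LooijengaLunts1997, §3 (3.5)] -/
theorem sigma_injective_neronSeveriQ (hG₀ : G₀.map ((↑) : ℚ → ℝ) = latticeGram Φ η₀) (hdet : IsUnit G₀.det) :
    Function.Injective fun L : neronSeveriQ Φ ↦
      sigma (nondegenerate_of_map_ratCast Φ hG₀ hdet) (L : E [⋀^Fin 2]→L[ℝ] ℝ) :=
  fun _ _ h ↦ Subtype.ext (sigma_injective _ h)

/-- `Tr_ℝ σ_L = Tr(G₀⁻¹ G_L)`: the scalar of (3.5) for a divisor class is half the RATIONAL trace of
`φ(L) = φ_{L₀}⁻¹ φ_L` (Looijenga–Lunts' "`Tr` denotes the `ℚ`-trace" of the proof of (3.7)).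
[cite: LooijengaLunts1997, §3 (3.5), proof of (3.7)] [cite: Lange2023AbelianVarietiesComplex, §2.4.1 (`Tr_r`), p. 114] -/
theorem trace_sigma_eq_ratCast_trace (hG₀ : G₀.map ((↑) : ℚ → ℝ) = latticeGram Φ η₀) (hdet : IsUnit G₀.det)
    (L : neronSeveriQ Φ) :
    LinearMap.trace ℝ E (sigma (nondegenerate_of_map_ratCast Φ hG₀ hdet) (L : E [⋀^Fin 2]→L[ℝ] ℝ)) =
      ((nsToEnd Φ G₀ L).trace : ℝ) := by
  rw [sigma_eq_analyticRepReal_nsToEnd Φ hG₀ hdet L, trace_analyticRepReal, Matrix.trace, Matrix.trace,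
    Rat.cast_sum]
  rfl

/-- **Proposition (3.5) for an abelian variety, assembled**: for the polarization `κ = η₀` and a divisor class
`λ = L ∈ NS(X) ⊗ ℚ`, on `H¹(X, ℂ) = V^* ⊗ ℂ`:
`[e_L, f_{η₀}] θ = θ ∘ ρ_a(φ_{L₀}⁻¹ φ_L) − ½ Tr(G₀⁻¹ G_L) θ` — the restriction to `V^*` is the transpose of the
analytic representation of the `†`-invariant element `φ_{L₀}⁻¹ φ_L ∈ End⁰(X)` plus a (rational) scalar.
[cite: LooijengaLunts1997, §3 (3.5)] -/
theorem lie_lefschetzG_lefschetzDualG_of_one_neronSeveriQ [Nontrivial E]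
    (hG₀ : G₀.map ((↑) : ℚ → ℝ) = latticeGram Φ η₀) (hdet : IsUnit G₀.det) (L : neronSeveriQ Φ)
    (θ : E [⋀^Fin 1]→L[ℝ] ℂ) :
    ⁅lefschetzG (L : E [⋀^Fin 2]→L[ℝ] ℝ), lefschetzDualG η₀⁆ (of 1 θ) =
      of 1 (θ.compContinuousLinearMap (analyticRepReal Φ Φ ((nsToEnd Φ G₀ L).map ((↑) : ℚ → ℝ))) -
        ((1 / 2 : ℝ) * ((nsToEnd Φ G₀ L).trace : ℝ)) • θ) := by
  rw [lie_lefschetzG_lefschetzDualG_of_one (nondegenerate_of_map_ratCast Φ hG₀ hdet),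
    trace_sigma_eq_ratCast_trace Φ hG₀ hdet L]
  have hσ : sigmaL (nondegenerate_of_map_ratCast Φ hG₀ hdet) (L : E [⋀^Fin 2]→L[ℝ] ℝ) =
      analyticRepReal Φ Φ ((nsToEnd Φ G₀ L).map ((↑) : ℚ → ℝ)) := by
    refine ContinuousLinearMap.ext fun a ↦ ?_
    rw [sigmaL_apply, sigma_eq_analyticRepReal_nsToEnd Φ hG₀ hdet L, ContinuousLinearMap.coe_coe]
  rw [hσ]

/-- **(3.5) for a polarised abelian variety `(X, L₀)`**: a Riemann form `η₀` supplies the rational invertible Gram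
matrix, so for every `L ∈ NS(X) ⊗ ℚ` the bracket `[e_L, f_{η₀}]` acts on `H¹` as `θ ↦ θ ∘ ρ_a(φ_{L₀}⁻¹ φ_L) − ½Tr·θ`
with `φ_{L₀}⁻¹ φ_L ∈ End^s_ℚ(X)`. [cite: LooijengaLunts1997, §3 (3.5)] -/
theorem IsRiemannForm.exists_lie_lefschetzG_lefschetzDualG_of_one [Nontrivial E] (hη₀ : IsRiemannForm Φ η₀)
    (L : neronSeveriQ Φ) :
    ∃ G₀ : Matrix ι ι ℚ, G₀.map ((↑) : ℚ → ℝ) = latticeGram Φ η₀ ∧ IsUnit G₀.det ∧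
      nsToEnd Φ G₀ L ∈ symmEndRat Φ G₀ ∧
      ∀ θ : E [⋀^Fin 1]→L[ℝ] ℂ, ⁅lefschetzG (L : E [⋀^Fin 2]→L[ℝ] ℝ), lefschetzDualG η₀⁆ (of 1 θ) =
        of 1 (θ.compContinuousLinearMap (analyticRepReal Φ Φ ((nsToEnd Φ G₀ L).map ((↑) : ℚ → ℝ))) -
          ((1 / 2 : ℝ) * ((nsToEnd Φ G₀ L).trace : ℝ)) • θ) := by
  obtain ⟨G₀, hG₀, hdet⟩ := hη₀.exists_ratMatrix_latticeGram_isUnit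
  exact ⟨G₀, hG₀, hdet, nsToEnd_mem_symmEndRat hη₀.1 hG₀ hdet L,
    fun θ ↦ lie_lefschetzG_lefschetzDualG_of_one_neronSeveriQ Φ hG₀ hdet L θ⟩

end Rational

end ComplexTorus

end Literature.Geometry.Kaehler
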